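import Literature.Analysis.FluidPDE.VorticityStretching
import Literature.Analysis.FluidPDE.Vorticity
import Literature.Analysis.FluidPDE.EnergyToolkit
import HarnessLib

/-!
# The vorticity equation of a classical Navier–Stokes / Euler solution

Analysis/FluidPDE support file. It proves the passage **velocity ⇒ vorticity formulation**
(Majda–Bertozzi, *Vorticity and Incompressible Flow*, §1.6 Prop. 1.12, eq. (1.33) for Euler;
§2.4 Prop. 2.4, eq. (2.110) for Navier–Stokes — the locators of `Vorticity.lean`): the curl of the
momentum equation of a classical solution with curl-free force is
`∂ₜω + (u·∇)ω = (ω·∇)u + νΔω`, `ω = curl u`.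

The two ingredients are in the tree: the stretching form of the curl of the momentum equation,
`curl ∂ₜu = νΔω − (u·∇)ω + (ω·∇)u + curl f` (`VorticityStretching`:
`IsClassicalNSSolutionOn.curl_timeDerivWithin_eq`, resting on
`curl ((u·∇)u) = (u·∇)ω − (ω·∇)u + (div u)ω`), and the exchange of the one-sided time derivative
with spatial derivatives (`EnergyToolkit`: `IsSmoothSpaceTimeOn.timeDerivWithin_fderiv_slice_apply`,
from the symmetry of the second derivative of `uncurry u` within `S × ℝ³`, available on time sets
with `S ⊆ closure (interior S)`). This file supplies `curl ∂ₜu = ∂ₜ curl u` in that setting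
(`IsSmoothSpaceTimeOn.curl_timeDerivWithin`) and assembles the vorticity formulation
`Fluid.IsVorticitySolutionOn S ν u`.

The tree records the implication as the named fact
`Fluid.IsClassicalNSSolutionOn.isVorticitySolutionOn` (`Vorticity.lean`), quantified over **all**
time sets `S` with `UniqueDiffOn ℝ S`; the exchange of mixed within-derivatives is only available
on `S ⊆ closure (interior S)` (every interval, but not e.g. a fat Cantor set, where no mean-value
argument in time exists). Accordingly the fact is proved here under that hypothesis
(`isVorticitySolutionOn_of_subset_closure_interior`) with its specialisations to `Ico 0 T`,
`Icc 0 T`, `Ici 0` and open sets — the cases used in the tree; the named fact itself is left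
untouched (its generality should be re-examined by its owner). The force only needs to be
curl-free: its smoothness is part of `IsClassicalNSSolutionOn` (`isSmoothSpaceTimeOn_force`).

## References

* A. J. Majda, A. L. Bertozzi, *Vorticity and Incompressible Flow*, CUP 2002, §1.6 Prop. 1.12,
  eq. (1.33); §2.4 Prop. 2.4, eq. (2.110).
-/

noncomputable section

open Set Function Filter Topology WithLp
open scoped Laplacian InnerProductSpace RealInnerProductSpace ContDiff

namespace Literature.Analysis.FluidPDE

/-- Local notation for physical space `ℝ³ = EuclideanSpace ℝ (Fin 3)`. -/
local notation "ℝ³" => EuclideanSpace ℝ (Fin 3)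

/-! ### `curl ∂ₜu = ∂ₜ curl u` up to the boundary of the time set -/

/-- **`curl ∂ₜu = ∂ₜ curl u` up to the boundary of the time set**: for a jointly smooth velocity
on `S × ℝ³`, `S` of unique differentiability with `S ⊆ closure (interior S)`, and `t ∈ S`,
`curl (timeDerivWithin S u t) x = timeDerivWithin S (vorticity u) t x` (the operator form of the
exchange of mixed partials, `EnergyToolkit`'s
`IsSmoothSpaceTimeOn.timeDerivWithin_fderiv_slice_apply`, followed by the linear map `curlCLM`). [folklore] -/
theorem IsSmoothSpaceTimeOn.curl_timeDerivWithin {S : Set ℝ} {u : ℝ → ℝ³ → ℝ³}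
    (h : IsSmoothSpaceTimeOn S u) (hS : UniqueDiffOn ℝ S) (hcl : S ⊆ closure (interior S))
    {t : ℝ} (ht : t ∈ S) (x : ℝ³) :
    curl (FluidPDE.timeDerivWithin S u t) x = FluidPDE.timeDerivWithin S (vorticity u) t x := by
  -- operator form of the exchange of `∂ₜ` and `D`
  have hop : FluidPDE.timeDerivWithin S (fun s y => fderiv ℝ (u s) y) t x =
      fderiv ℝ (FluidPDE.timeDerivWithin S u t) x := by
    ext a
    rw [← h.timeDerivWithin_fderiv_slice_apply hS hcl ht x a, timeDerivWithin_apply,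
      timeDerivWithin_apply,
      derivWithin_clm_apply ((h.fderiv_slice hS).differentiableWithinAt_time ht x)
        (differentiableWithinAt_const _)]
    simp
  have hv : vorticity u = fun s y => curlCLM (fderiv ℝ (u s) y) := by
    funext s y; rfl
  rw [curl_eq_curlCLM, ← hop, hv, (h.fderiv_slice hS).timeDerivWithin_clm_comp hS curlCLM ht x]

/-! ### The vorticity equation -/

section VorticityEq

variable {S : Set ℝ} {ν : ℝ} {f u : ℝ → ℝ³ → ℝ³} {p : ℝ → ℝ³ → ℝ}

/-- **The vorticity equation of a classical solution** (Majda–Bertozzi, §1.6 Prop. 1.12 /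
eq. (1.33), §2.4 Prop. 2.4 / eq. (2.110)): for a classical Navier–Stokes solution with curl-free
force on a time set `S` of unique differentiability with `S ⊆ closure (interior S)`, at every
`t ∈ S`, `∂ₜω + (u·∇)ω = (ω·∇)u + νΔω`, `ω = curl u`. Proof: `VorticityStretching`'s
`curl ∂ₜu = νΔω − (u·∇)ω + (ω·∇)u + curl f` and `curl ∂ₜu = ∂ₜω` (`curl_timeDerivWithin`). [folklore] -/
theorem IsClassicalNSSolutionOn.vorticity_eq (h : IsClassicalNSSolutionOn S ν f u p)
    (hS : UniqueDiffOn ℝ S) (hcl : S ⊆ closure (interior S))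
    (hcurl : ∀ t ∈ S, ∀ x, curl (f t) x = 0) {t : ℝ} (ht : t ∈ S) (x : ℝ³) :
    timeDerivWithin S (vorticity u) t x + convect (u t) (vorticity u t) x =
      convect (vorticity u t) (u t) x + ν • (Δ (vorticity u t)) x := by
  rw [← h.smooth_velocity.curl_timeDerivWithin hS hcl ht x, h.curl_timeDerivWithin_eq hS ht x,
    hcurl t ht x, vorticity_apply]
  abel

/-- **Velocity ⇒ vorticity formulation on interval-like time sets**
(Majda–Bertozzi, §1.6 Prop. 1.12, §2.4 Prop. 2.4): a classical Navier–Stokes solution with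
curl-free force on a time set `S` of unique differentiability with `S ⊆ closure (interior S)`
(every interval) is a solution of the vorticity formulation `Fluid.IsVorticitySolutionOn S ν u`.
This is the named fact `IsClassicalNSSolutionOn.isVorticitySolutionOn` of `Vorticity.lean` under
the additional hypothesis `S ⊆ closure (interior S)`, which is what the exchange of the one-sided
time derivative with the curl requires (and without its smoothness hypothesis on the force,
which is automatic). [folklore] -/
theorem IsClassicalNSSolutionOn.isVorticitySolutionOn_of_subset_closure_interior
    (h : IsClassicalNSSolutionOn S ν f u p) (hS : UniqueDiffOn ℝ S)
    (hS' : S ⊆ closure (interior S)) (hcurl : ∀ t ∈ S, ∀ x, curl (f t) x = 0) :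
    IsVorticitySolutionOn S ν u where
  smooth_velocity := h.smooth_velocity
  vorticity_eq _ ht x := h.vorticity_eq hS hS' hcurl ht x
  divFree := h.divFree

/-- The vorticity formulation on an open time set. [folklore] -/
theorem IsClassicalNSSolutionOn.isVorticitySolutionOn_of_isOpen
    (h : IsClassicalNSSolutionOn S ν f u p) (hS : IsOpen S)
    (hcurl : ∀ t ∈ S, ∀ x, curl (f t) x = 0) : IsVorticitySolutionOn S ν u :=
  h.isVorticitySolutionOn_of_subset_closure_interior hS.uniqueDiffOn
    (by rw [hS.interior_eq]; exact subset_closure) hcurl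

/-- The vorticity formulation on `[0, T)` (the time set of maximal solutions). [folklore] -/
theorem IsClassicalNSSolutionOn.isVorticitySolutionOn_Ico {T : ℝ}
    (h : IsClassicalNSSolutionOn (Ico 0 T) ν f u p)
    (hcurl : ∀ t ∈ Ico 0 T, ∀ x, curl (f t) x = 0) : IsVorticitySolutionOn (Ico 0 T) ν u := by
  refine h.isVorticitySolutionOn_of_subset_closure_interior (uniqueDiffOn_Ico 0 T) ?_ hcurl
  rcases le_or_gt T 0 with hT | hT
  · rw [Ico_eq_empty (not_lt.2 hT)]; exact empty_subset _
  · rw [interior_Ico, closure_Ioo hT.ne]; exact Ico_subset_Icc_self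

/-- The vorticity formulation on `[0, T]`, `T ≠ 0` (for `T < 0` the time set is empty; the
degenerate `T = 0` is excluded since `{0}` is not a set of unique differentiability). [folklore] -/
theorem IsClassicalNSSolutionOn.isVorticitySolutionOn_Icc {T : ℝ} (hT : T ≠ 0)
    (h : IsClassicalNSSolutionOn (Icc 0 T) ν f u p)
    (hcurl : ∀ t ∈ Icc 0 T, ∀ x, curl (f t) x = 0) : IsVorticitySolutionOn (Icc 0 T) ν u := by
  rcases lt_or_gt_of_ne hT with hT' | hT'
  · have he : Icc (0 : ℝ) T = ∅ := Icc_eq_empty (not_le.2 hT')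
    refine h.isVorticitySolutionOn_of_subset_closure_interior ?_ ?_ hcurl
    · rw [he]; exact uniqueDiffOn_empty
    · rw [he]; exact empty_subset _
  · refine h.isVorticitySolutionOn_of_subset_closure_interior (uniqueDiffOn_Icc hT') ?_ hcurl
    rw [interior_Icc, closure_Ioo hT'.ne]

/-- The vorticity formulation on `[0, ∞)` (global classical solutions). [folklore] -/
theorem IsClassicalNSSolutionOn.isVorticitySolutionOn_Ici
    (h : IsClassicalNSSolutionOn (Ici 0) ν f u p)
    (hcurl : ∀ t ∈ Ici (0 : ℝ), ∀ x, curl (f t) x = 0) : IsVorticitySolutionOn (Ici 0) ν u := by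
  refine h.isVorticitySolutionOn_of_subset_closure_interior (uniqueDiffOn_Ici 0) ?_ hcurl
  rw [interior_Ici, closure_Ioi]

/-- The unforced case: a classical solution of the unforced system on an interval-like time set
solves the vorticity formulation (the direction `⇐` of `NS.isVorticitySolutionOn_iff`). [folklore] -/
theorem IsClassicalNSSolutionOn.isVorticitySolutionOn_zero_force {u : ℝ → ℝ³ → ℝ³}
    {p : ℝ → ℝ³ → ℝ} (h : IsClassicalNSSolutionOn S ν 0 u p) (hS : UniqueDiffOn ℝ S)
    (hS' : S ⊆ closure (interior S)) : IsVorticitySolutionOn S ν u :=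
  h.isVorticitySolutionOn_of_subset_closure_interior hS hS' fun _ _ x => curl_zero x

end VorticityEq

end Literature.Analysis.FluidPDE
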